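import Summits.QuantumFields.BalabanUV.T4Continuum.Support.ShellMeasureExpHaarClosedBallSUN
import Summits.QuantumFields.BalabanUV.T4Continuum.Support.ShellMeasureLogConcaveJacobian
import Literature.Analysis.Matrix.HoffmanWielandt

/-!
# `T4Continuum.ShellMeasureLogConcaveDetSUN` — `log det T_v` IS CONCAVE on the closed Hilbert–Schmidt ball `‖v‖ ≤ π`
# of the `SU(N)` exponential chart, every `N`: the chart's Haar Jacobian `J(v) = det T_v = ∏_{i<j} sinc²((θ_j − θ_i)/2)`
# satisfies the three-point inequality `J(a v₀ + b v₁) ≥ J(v₀)^a J(v₁)^b`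
# (cell `pub-balaban`, sub-cell `t4`, spine estimate NE7c (node U5b); ROUND-2 crew `t4-ne7c-formalise-*`, seat
# `b2b-balaban-t4-ne7c-formalise-leaf-04` (gen 2); row S3 «SM-L9 SU(N) chart» of `t4/b2b-balaban-t4-ne7c-p1/LEAVES-NE7c-P1.md`,
# whose description reads «exponential chart + Haar Jacobian `∏_{α>0} sinc²(α(X)/2)` centre-monotone ∕ log-concave +
# dictionary» — gen 1 delivered chart, dictionary and CENTRE-MONOTONICITY (`ShellMeasureExpJacobianSUN.expJacSU_le_smul`);
# this file and its companion `ShellMeasureLogConcaveJacobianSUN` deliver the LOG-CONCAVITY (journal `CLAIMS.log`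
# «OFFER∕INTENT NE7c-S3 RESIDUAL», guard NE7cLEAF04-G2-ONLINE-1); tree target
# `Summits/QuantumFields/BalabanUV/T4Continuum/Support/`; ADDITIVE — imports the (CH)₁ line's closed-window file
# `ShellMeasureExpHaarClosedBallSUN` (`det T_v > 0`, all eigenvalue gaps `< 2π` on `‖v‖ ≤ π`), the lineage-P1 member-(λ)
# module `ShellMeasureLogConcaveJacobian` (`log ∘ sinc` concave on `[0, π)`) and the tree's
# `Literature.Analysis.Matrix.HoffmanWielandt` (`[|u_ij|²]` is doubly stochastic) only; modifies nothing; 0 `def`, 0 sorry,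
# 0 citations, no `def … : Prop`)

HONEST FRAMING.  Finite four-torus programme, rung (B)+1 only — NOT infinite volume, NOT a mass gap, NOT the Clay
problem, NOT summit progress.  Nothing of [Balaban 1983–89] is asserted.  What lands is CLASSICAL and kernel-proved: a
symmetric concave function of the eigenvalues is concave in the Hermitian matrix (Davis 1957 ∕ Lewis 1996 — a LOCATOR for
the folklore, not a citation tag; textbook proof: Schur «the diagonal is a doubly-stochastic image of the spectrum» +
Birkhoff (Mathlib) + Jensen), applied to Weyl's Jacobian profile `Σ_{i,j} log sinc((θ_j − θ_i)/2)`.  The cell wall of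
NE7c — (M1) FOR BAŁABAN'S INDUCTIVELY DEFINED EFFECTIVE MEASURES at live levels ⇐ SM-L1/SM-L4/SM-L6 + node U1b's rate — is
NOT PRINTED (GAPS G-ne7cp1-1) and NOT moved: row S3 is the optional `SU(N)` road (trigger c5), `SU(2)` the row's certified
instance, member (λ) a typed census member resting on the located DESIGN reading (λ-1) «convex classifiers»; NOTHING in
the countdown moves (spine PROVED 0/9); «NE7c ⇐ the named binders», never «NE7c proved».  [folklore] throughout.
HONEST DEPENDENCY (cell, verbatim): continuum YM on T⁴ ⇐ BetaPertH ∧ nine spine estimates (0/9 proved);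
BetaPertH ⇐ (D1) ∧ (D4) ∧ CAP+tail; G-an2-4 gates asym, D1 and NE2/3/4.

WHICH JACOBIAN.  S3 f4's determinant QUOTIENT `expJacSU` VANISHES on the non-regular cone (e.g. `expJacSU 0 = 0`) and is
NOT log-concave as a function; the (CH)₁ line's `det T_v` (`T_v = ShellMeasureExpDuhamelSUN.duhT v`;
`ShellMeasureExpDuhamelDetSUN.det_eq_prod_sinc` for EVERY unitary diagonalisation; `= expJacSU` off the cone;
`jacM = |det T_v|`, `jacM =ᵐ expJacSU`) is the CONTINUOUS representative and the subject of this file.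

THE POINTS (all [folklore]).  §1 `concaveOn_log_sinc_Ioo`: `log ∘ sinc` concave on `(−π, π)`.  §2 the ROOT-SPACE PROFILE
`θ ↦ Σ_i Σ_j log sinc((θ_j − θ_i)/2)` on the GAP DOMAIN `{θ | ∀ i j, |θ_j − θ_i| < 2π}` (convex `convex_gapDom`,
permutation-invariant): permutation-invariant (`logSincSum_comp_perm`), CONCAVE (`concaveOn_logSincSum`), with exponential
`∏_i ∏_j sinc((θ_j − θ_i)/2) = ∏_i ∏_{j>i} sinc²((θ_j − θ_i)/2)` (`exp_logSincSum`, `prod_prod_eq_prod_Ioi_sq`).  §3 SCHUR'S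
STEP `logSincSum_diag_ge`: for `‖v‖ ≤ π` and ANY unitary `U` the real diagonal `d_k = Re (U* H(v) U)_{kk}` is `B·θ(v)`,
`B = [|w_kl|²]`, `W = U*U₀` unitary (`HoffmanWielandt.normSqEntries_mem_doublyStochastic` BY NAME); Birkhoff (Mathlib
`exists_eq_sum_perm_of_mem_doublyStochastic`) + Jensen (`ConcaveOn.le_map_sum`) + permutation invariance ⟹ `d` lies in the
gap domain and its profile is `≥ log det T_v` (`log_det_duhT_eq`).  §4 DAVIS'S STEP: the eigenvalue angles of
`H(a v₀ + b v₁)` ARE `a·d⁰ + b·d¹`, `dⁱ` the diagonals of `H(vᵢ)` in the eigenframe of the combination (`eigen_eq_re_diag`,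
`re_diag_convexComb`; `ShellMeasureRegularConeSUN.herm_add` BY NAME) ⟹ **`log_det_duhT_convexComb_ge`** and **`det_duhT_threePoint`**
`(det T_{v₀})^a (det T_{v₁})^b ≤ det T_{a v₀ + b v₁}` (`‖v₀‖, ‖v₁‖ ≤ π`, `a, b ≥ 0`, `a + b = 1`).  The companion
`ShellMeasureLogConcaveJacobianSUN` packages this as `IsLogConcaveWeight` statements (member (λ)'s currency).

WHAT THIS DOES NOT DO.  No realized member-(λ) headline; no instance of (C-i)/(C-ii)/(C-iii) for Bałaban's sectioned block
weights or classifiers; (Det), (FI-sat), (LR), (MR), (W1), the (F∞)-rate keep their status.  NE7c NOT proved.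
-/

noncomputable section

namespace Summit.QuantumFields.BalabanUV.T4Continuum.ShellMeasureLogConcaveDetSUN

open MeasureTheory Set Function Finset Matrix Metric
open scoped ENNReal
open Literature.MathematicalPhysics.QuantumFieldTheory.Balaban1983to89
open ShellMeasureExpChartSUN (ChartSU genSU genSU_smul)
open ShellMeasureExpJacobianSUN (herm herm_smul exists_conjDiag sinc_abs)
open ShellMeasureVandermondeSUN (conjDiag star_coe_mul_coe coe_mul_star_coe)
open ShellMeasureExpDuhamelSUN (duhT genSU_duhT_eq_integral)
open ShellMeasureExpDuhamelDetSUN (sinc_pos_of_abs_lt_pi prod_sinc_sq_pos det_eq_prod_sinc det_mem_Icc)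
open ShellMeasureExpHaarClosedBallSUN (abs_sub_eigen_lt_two_pi det_duhT_pos_of_norm_le_pi)
open ShellMeasureRegularConeSUN (herm_add)
open ShellMeasureScalingSU2 (sinc_le_sinc_of_le_of_le_pi)
open ShellMeasureLogConcaveJacobian (sinc_pos_of_mem_Ico concaveOn_log_sinc)

/-! ## §1 `log ∘ sinc` is concave on `(−π, π)` -/

section Sinc

/-- `log ∘ sinc` is NON-INCREASING on `[0, π)`. [folklore] -/
theorem log_sinc_antitoneOn : AntitoneOn (fun r => Real.log (Real.sinc r)) (Ico 0 Real.pi) := by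
  intro r hr r' hr' hrr'
  obtain ⟨-, hle⟩ := sinc_le_sinc_of_le_of_le_pi hr.1 hrr' hr'.2.le
  exact Real.log_le_log (sinc_pos_of_mem_Ico hr') hle

/-- **`log ∘ sinc` IS CONCAVE ON `(−π, π)`**: `sinc` is even, non-increasing on `[0, π]` and `log ∘ sinc` is concave on
`[0, π)` (`ShellMeasureLogConcaveJacobian.concaveOn_log_sinc`); `|ax + by| ≤ a|x| + b|y|`. [folklore] -/
theorem concaveOn_log_sinc_Ioo :
    ConcaveOn ℝ (Ioo (-Real.pi) Real.pi) (fun r => Real.log (Real.sinc r)) := by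
  refine ⟨convex_Ioo _ _, fun x hx y hy a b ha hb hab => ?_⟩
  have hx' : |x| ∈ Ico 0 Real.pi := ⟨abs_nonneg x, abs_lt.mpr hx⟩
  have hy' : |y| ∈ Ico 0 Real.pi := ⟨abs_nonneg y, abs_lt.mpr hy⟩
  have hm : a * |x| + b * |y| ∈ Ico 0 Real.pi := by
    have := (convex_Ico 0 Real.pi) hx' hy' ha hb hab
    simpa only [smul_eq_mul] using this
  have habs : |a * x + b * y| ≤ a * |x| + b * |y| := by
    calc |a * x + b * y| ≤ |a * x| + |b * y| := abs_add_le _ _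
      _ = a * |x| + b * |y| := by rw [abs_mul, abs_mul, abs_of_nonneg ha, abs_of_nonneg hb]
  have hz : |a * x + b * y| ∈ Ico 0 Real.pi := ⟨abs_nonneg _, habs.trans_lt hm.2⟩
  have h1 := concaveOn_log_sinc.2 hx' hy' ha hb hab
  simp only [smul_eq_mul] at h1 ⊢
  rw [sinc_abs, sinc_abs] at h1
  refine h1.trans ?_
  have h2 : Real.log (Real.sinc (a * |x| + b * |y|)) ≤ Real.log (Real.sinc |a * x + b * y|) :=
    log_sinc_antitoneOn hz hm habs
  rwa [sinc_abs] at h2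

end Sinc

/-! ## §2 The root-space profile on the gap domain -/

section RootSpace

variable {N : ℕ}

/-- a convex combination of two numbers `< c` is `< c`. [folklore] -/
theorem convexComb_lt {x y c a b : ℝ} (hx : x < c) (hy : y < c) (ha : 0 ≤ a) (hb : 0 ≤ b) (hab : a + b = 1) :
    a * x + b * y < c := by
  rcases ha.eq_or_lt with rfl | ha'
  · rw [zero_add] at hab; rw [hab, zero_mul, zero_add, one_mul]; exact hy
  · have hc : a * c + b * c = c := by rw [← add_mul, hab, one_mul]
    nlinarith [mul_lt_mul_of_pos_left hx ha', mul_le_mul_of_nonneg_left hy.le hb]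

/-- THE GAP DOMAIN `{θ | ∀ i j, |θ_j − θ_i| < 2π}` IS CONVEX. [folklore] -/
theorem convex_gapDom : Convex ℝ {θ : Fin N → ℝ | ∀ i j, |θ j - θ i| < 2 * Real.pi} := by
  intro θ hθ θ' hθ' a b ha hb hab i j
  have hθij := hθ i j; have hθ'ij := hθ' i j
  simp only [Pi.add_apply, Pi.smul_apply, smul_eq_mul] at hθij hθ'ij ⊢
  have heq : a * θ j + b * θ' j - (a * θ i + b * θ' i) = a * (θ j - θ i) + b * (θ' j - θ' i) := by ring
  rw [heq]
  calc |a * (θ j - θ i) + b * (θ' j - θ' i)| ≤ |a * (θ j - θ i)| + |b * (θ' j - θ' i)| := abs_add_le _ _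
    _ = a * |θ j - θ i| + b * |θ' j - θ' i| := by rw [abs_mul, abs_mul, abs_of_nonneg ha, abs_of_nonneg hb]
    _ < 2 * Real.pi := convexComb_lt hθij hθ'ij ha hb hab

/-- the gap domain is PERMUTATION-INVARIANT. [folklore] -/
theorem comp_perm_mem_gapDom {θ : Fin N → ℝ} (hθ : θ ∈ {θ : Fin N → ℝ | ∀ i j, |θ j - θ i| < 2 * Real.pi})
    (σ : Equiv.Perm (Fin N)) : θ ∘ σ ∈ {θ : Fin N → ℝ | ∀ i j, |θ j - θ i| < 2 * Real.pi} :=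
  fun i j => hθ (σ i) (σ j)

/-- on the gap domain every half-gap lies in `(−π, π)`. [folklore] -/
theorem half_gap_mem_Ioo {θ : Fin N → ℝ} (hθ : θ ∈ {θ : Fin N → ℝ | ∀ i j, |θ j - θ i| < 2 * Real.pi})
    (i j : Fin N) : (θ j - θ i) / 2 ∈ Ioo (-Real.pi) Real.pi := by
  have h := hθ i j
  rw [Set.mem_Ioo, ← abs_lt, abs_div, abs_two]
  linarith

/-- THE ROOT-SPACE PROFILE `Σ_i Σ_j log sinc((θ_j − θ_i)/2)` IS PERMUTATION-INVARIANT. [folklore] -/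
theorem logSincSum_comp_perm (θ : Fin N → ℝ) (σ : Equiv.Perm (Fin N)) :
    (∑ i, ∑ j, Real.log (Real.sinc (((θ ∘ σ) j - (θ ∘ σ) i) / 2))) =
      ∑ i, ∑ j, Real.log (Real.sinc ((θ j - θ i) / 2)) := by
  simp only [Function.comp_apply]
  have hin : ∀ i, (∑ j, Real.log (Real.sinc ((θ (σ j) - θ (σ i)) / 2))) =
      ∑ j, Real.log (Real.sinc ((θ j - θ (σ i)) / 2)) :=
    fun i => Equiv.sum_comp σ (fun j => Real.log (Real.sinc ((θ j - θ (σ i)) / 2)))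
  simp_rw [hin]
  exact Equiv.sum_comp σ (fun i => ∑ j, Real.log (Real.sinc ((θ j - θ i) / 2)))

/-- **THE ROOT-SPACE PROFILE IS CONCAVE ON THE GAP DOMAIN** (termwise: `log ∘ sinc` concave on `(−π, π)` composed with
the linear forms `θ ↦ (θ_j − θ_i)/2`). [folklore] -/
theorem concaveOn_logSincSum :
    ConcaveOn ℝ {θ : Fin N → ℝ | ∀ i j, |θ j - θ i| < 2 * Real.pi}
      (fun θ => ∑ i, ∑ j, Real.log (Real.sinc ((θ j - θ i) / 2))) := by
  refine ⟨convex_gapDom, fun θ hθ θ' hθ' a b ha hb hab => ?_⟩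
  simp only [smul_eq_mul]
  rw [Finset.mul_sum, Finset.mul_sum, ← Finset.sum_add_distrib]
  refine Finset.sum_le_sum fun i _ => ?_
  rw [Finset.mul_sum, Finset.mul_sum, ← Finset.sum_add_distrib]
  refine Finset.sum_le_sum fun j _ => ?_
  have h := concaveOn_log_sinc_Ioo.2 (half_gap_mem_Ioo hθ i j) (half_gap_mem_Ioo hθ' i j) ha hb hab
  simp only [smul_eq_mul] at h
  have heq : ((a • θ + b • θ') j - (a • θ + b • θ') i) / 2 = a * ((θ j - θ i) / 2) + b * ((θ' j - θ' i) / 2) := by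
    simp only [Pi.add_apply, Pi.smul_apply, smul_eq_mul]; ring
  rw [heq]; exact h

/-- on the gap domain the exponential of the profile is the FULL SQUARE PRODUCT `∏_i ∏_j sinc((θ_j − θ_i)/2)` (every factor
is positive there). [folklore] -/
theorem exp_logSincSum {θ : Fin N → ℝ} (hθ : θ ∈ {θ : Fin N → ℝ | ∀ i j, |θ j - θ i| < 2 * Real.pi}) :
    Real.exp (∑ i, ∑ j, Real.log (Real.sinc ((θ j - θ i) / 2))) = ∏ i, ∏ j, Real.sinc ((θ j - θ i) / 2) := by
  rw [Real.exp_sum]; refine Finset.prod_congr rfl fun i _ => ?_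
  rw [Real.exp_sum]; refine Finset.prod_congr rfl fun j _ => ?_
  exact Real.exp_log (sinc_pos_of_abs_lt_pi (abs_lt.mpr (half_gap_mem_Ioo hθ i j)))

/-- a FULL SQUARE product of a SYMMETRIC family with UNIT DIAGONAL is the strict upper-triangular product of its SQUARES.
[folklore] -/
theorem prod_prod_eq_prod_Ioi_sq {M : Type*} [CommMonoid M] (g : Fin N → Fin N → M)
    (hsymm : ∀ i j, g i j = g j i) (hdiag : ∀ i, g i i = 1) :
    ∏ i, ∏ j, g i j = ∏ i, ∏ j ∈ Ioi i, g i j ^ 2 := by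
  classical
  have hT : ∏ p ∈ univ.filter (fun p : Fin N × Fin N => p.1 < p.2), g p.1 p.2 = ∏ i, ∏ j ∈ Ioi i, g i j :=
    Finset.prod_finset_product _ _ _ (fun p => by simp)
  have hL : ∏ p ∈ univ.filter (fun p : Fin N × Fin N => p.2 < p.1), g p.1 p.2 =
      ∏ p ∈ univ.filter (fun p : Fin N × Fin N => p.1 < p.2), g p.1 p.2 := by
    refine Finset.prod_equiv (Equiv.prodComm (Fin N) (Fin N)) (fun p => ?_) (fun p _ => ?_)
    · simp only [Finset.mem_filter, Finset.mem_univ, true_and, Equiv.prodComm_apply, Prod.fst_swap, Prod.snd_swap]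
    · simp only [Equiv.prodComm_apply, Prod.fst_swap, Prod.snd_swap]; exact hsymm _ _
  have hD : ∏ p ∈ (univ.filter fun p : Fin N × Fin N => ¬ p.1 < p.2).filter (fun p => ¬ p.2 < p.1), g p.1 p.2 = 1 := by
    refine Finset.prod_eq_one fun p hp => ?_
    simp only [Finset.mem_filter, Finset.mem_univ, true_and, not_lt] at hp
    rw [le_antisymm hp.1 hp.2]; exact hdiag _
  have hsplit : (univ.filter fun p : Fin N × Fin N => ¬ p.1 < p.2).filter (fun p => p.2 < p.1) =
      univ.filter fun p : Fin N × Fin N => p.2 < p.1 := by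
    ext p; simp only [Finset.mem_filter, Finset.mem_univ, true_and, and_iff_right_iff_imp]
    exact fun h => not_lt.mpr h.le
  calc ∏ i, ∏ j, g i j = ∏ p ∈ (univ : Finset (Fin N)) ×ˢ (univ : Finset (Fin N)), g p.1 p.2 :=
        (Finset.prod_product (s := univ) (t := univ) (f := fun p : Fin N × Fin N => g p.1 p.2)).symm
    _ = (∏ p ∈ univ.filter (fun p : Fin N × Fin N => p.1 < p.2), g p.1 p.2) *
          ∏ p ∈ univ.filter (fun p : Fin N × Fin N => ¬ p.1 < p.2), g p.1 p.2 := by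
        rw [univ_product_univ, Finset.prod_filter_mul_prod_filter_not]
    _ = (∏ p ∈ univ.filter (fun p : Fin N × Fin N => p.1 < p.2), g p.1 p.2) *
          ((∏ p ∈ (univ.filter fun p : Fin N × Fin N => ¬ p.1 < p.2).filter (fun p => p.2 < p.1), g p.1 p.2) *
            ∏ p ∈ (univ.filter fun p : Fin N × Fin N => ¬ p.1 < p.2).filter (fun p => ¬ p.2 < p.1), g p.1 p.2) := by
        rw [Finset.prod_filter_mul_prod_filter_not (s := univ.filter fun p : Fin N × Fin N => ¬ p.1 < p.2)
          (p := fun p : Fin N × Fin N => p.2 < p.1)]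
    _ = (∏ i, ∏ j ∈ Ioi i, g i j) * (∏ i, ∏ j ∈ Ioi i, g i j) := by rw [hD, mul_one, hsplit, hL, hT]
    _ = ∏ i, ∏ j ∈ Ioi i, g i j ^ 2 := by
        rw [← sq, ← Finset.prod_pow]; exact Finset.prod_congr rfl fun i _ => (Finset.prod_pow _ 2 _).symm

/-- the full square `sinc` product is the root-space product `∏_{i<j} sinc²((θ_j − θ_i)/2)`. [folklore] -/
theorem prod_prod_sinc_eq (θ : Fin N → ℝ) :
    ∏ i, ∏ j, Real.sinc ((θ j - θ i) / 2) = ∏ i : Fin N, ∏ j ∈ Ioi i, Real.sinc ((θ j - θ i) / 2) ^ 2 := by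
  refine prod_prod_eq_prod_Ioi_sq (fun i j => Real.sinc ((θ j - θ i) / 2)) (fun i j => ?_) (fun i => ?_)
  · rw [← Real.sinc_neg, ← neg_div, neg_sub]
  · rw [sub_self, zero_div, Real.sinc_zero]

end RootSpace

/-! ## §3 Schur's step: in any unitary frame the diagonal of `H(v)` is a doubly-stochastic image of the spectrum -/

section Schur

variable {N : ℕ}

/-- CHANGE OF FRAME: `U* · (U₀·diag d·U₀*) · U = W·diag d·Wᴴ` with `W = U*U₀`. [folklore] -/
theorem star_mul_conjDiag_mul (U U₀ : Matrix.unitaryGroup (Fin N) ℂ) (d : Fin N → ℂ) :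
    star (U : Matrix (Fin N) (Fin N) ℂ) * conjDiag U₀ d * (U : Matrix (Fin N) (Fin N) ℂ) =
      (star (U : Matrix (Fin N) (Fin N) ℂ) * (U₀ : Matrix (Fin N) (Fin N) ℂ)) * diagonal d *
        (star (U : Matrix (Fin N) (Fin N) ℂ) * (U₀ : Matrix (Fin N) (Fin N) ℂ))ᴴ := by
  unfold conjDiag
  rw [conjTranspose_mul, ← star_eq_conjTranspose, ← star_eq_conjTranspose, star_star]
  simp only [Matrix.mul_assoc]

/-- THE REAL DIAGONAL OF `W·diag θ·Wᴴ`: `Re (W diag θ Wᴴ)_{kk} = Σ_l |w_kl|²·θ_l`. [folklore] -/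
theorem re_conj_diagonal_apply_diag (W : Matrix (Fin N) (Fin N) ℂ) (θ : Fin N → ℝ) (k : Fin N) :
    ((W * diagonal (fun l => (θ l : ℂ)) * Wᴴ) k k).re = ∑ l, ‖W k l‖ ^ 2 * θ l := by
  rw [Matrix.mul_apply, Complex.re_sum]
  refine Finset.sum_congr rfl fun l _ => ?_
  rw [Matrix.mul_diagonal, Matrix.conjTranspose_apply, Complex.star_def, mul_comm (W k l) _, mul_assoc,
    Complex.mul_conj, ← Complex.ofReal_mul, Complex.ofReal_re, Complex.normSq_eq_norm_sq, mul_comm]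

/-- under a unitary diagonalisation `H(v) = U₀·diag θ·U₀*` with `‖v‖ ≤ π`: `log det T_v = Σ_i Σ_j log sinc((θ_j − θ_i)/2)`
(`det_duhT_eq_prod_sinc` + §2; all gaps `< 2π` by `abs_sub_eigen_lt_two_pi`). [folklore] -/
theorem log_det_duhT_eq {v : ChartSU N} {U₀ : Matrix.unitaryGroup (Fin N) ℂ} {θ : Fin N → ℝ}
    (h0 : herm v = conjDiag U₀ fun k => (θ k : ℂ)) (hv : ‖v‖ ≤ Real.pi) :
    Real.log (LinearMap.det (duhT v : ChartSU N →ₗ[ℝ] ChartSU N)) =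
      ∑ i, ∑ j, Real.log (Real.sinc ((θ j - θ i) / 2)) := by
  have hθ : θ ∈ {θ : Fin N → ℝ | ∀ i j, |θ j - θ i| < 2 * Real.pi} := fun i j => abs_sub_eigen_lt_two_pi h0 hv i j
  rw [det_eq_prod_sinc h0 _ (genSU_duhT_eq_integral v), ← prod_prod_sinc_eq, ← exp_logSincSum hθ, Real.log_exp]

/-- **SCHUR'S STEP.**  For `‖v‖ ≤ π` and ANY unitary `U`, the real diagonal `d_k = Re (U* H(v) U)_{kk}` of the Hermitian
generator in the frame `U` lies in the gap domain and its root-space profile dominates `log det T_v`: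
`d = B·θ(v)` with `B = [|w_kl|²]` doubly stochastic (`W = U*U₀`, `HoffmanWielandt.normSqEntries_mem_doublyStochastic`),
`B = Σ_σ c_σ P_σ` (Birkhoff, Mathlib `exists_eq_sum_perm_of_mem_doublyStochastic`), Jensen for the concave profile
(`ConcaveOn.le_map_sum`) and permutation invariance. [folklore] -/
theorem logSincSum_diag_ge {v : ChartSU N} (hv : ‖v‖ ≤ Real.pi) (U : Matrix.unitaryGroup (Fin N) ℂ) :
    (fun k => ((star (U : Matrix (Fin N) (Fin N) ℂ) * herm v * (U : Matrix (Fin N) (Fin N) ℂ)) k k).re) ∈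
        {θ : Fin N → ℝ | ∀ i j, |θ j - θ i| < 2 * Real.pi} ∧
      Real.log (LinearMap.det (duhT v : ChartSU N →ₗ[ℝ] ChartSU N)) ≤
        ∑ i, ∑ j, Real.log (Real.sinc
          ((((star (U : Matrix (Fin N) (Fin N) ℂ) * herm v * (U : Matrix (Fin N) (Fin N) ℂ)) j j).re -
            ((star (U : Matrix (Fin N) (Fin N) ℂ) * herm v * (U : Matrix (Fin N) (Fin N) ℂ)) i i).re) / 2)) := by
  obtain ⟨U₀, θ, h0⟩ := exists_conjDiag v
  have hθ : θ ∈ {θ : Fin N → ℝ | ∀ i j, |θ j - θ i| < 2 * Real.pi} := fun i j => abs_sub_eigen_lt_two_pi h0 hv i j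
  -- the frame-change matrix `W = U*U₀` is unitary, so `B = [|w_kl|²]` is doubly stochastic (Schur)
  set W : Matrix (Fin N) (Fin N) ℂ := star (U : Matrix (Fin N) (Fin N) ℂ) * (U₀ : Matrix (Fin N) (Fin N) ℂ)
  have hWW : Wᴴ * W = 1 := by
    rw [← Matrix.star_eq_conjTranspose]; exact Unitary.coe_star_mul_self (star U * U₀)
  have hWW' : W * Wᴴ = 1 := by
    rw [← Matrix.star_eq_conjTranspose]; exact Unitary.coe_mul_star_self (star U * U₀)
  have hBds := Literature.Analysis.Matrix.HoffmanWielandt.normSqEntries_mem_doublyStochastic hWW hWW'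
  set d : Fin N → ℝ :=
    fun k => ((star (U : Matrix (Fin N) (Fin N) ℂ) * herm v * (U : Matrix (Fin N) (Fin N) ℂ)) k k).re with hd
  have hframe : star (U : Matrix (Fin N) (Fin N) ℂ) * herm v * (U : Matrix (Fin N) (Fin N) ℂ) =
      W * diagonal (fun l => (θ l : ℂ)) * Wᴴ := by
    rw [h0, star_mul_conjDiag_mul]
  have hdB : d = (Matrix.of fun k l => ‖W k l‖ ^ 2 : Matrix (Fin N) (Fin N) ℝ) *ᵥ θ := by
    funext k; simp only [hd, Matrix.mulVec, dotProduct, Matrix.of_apply]; rw [hframe, re_conj_diagonal_apply_diag]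
  -- Birkhoff: `B = Σ_σ c_σ P_σ`, so `d = Σ_σ c_σ (θ ∘ σ)`, which lies in the (convex, symmetric) gap domain
  obtain ⟨c, hc0, hc1, hcB⟩ := exists_eq_sum_perm_of_mem_doublyStochastic hBds
  have hdsum : d = ∑ σ : Equiv.Perm (Fin N), c σ • (θ ∘ σ) := by
    rw [hdB, ← hcB, Matrix.sum_mulVec]
    exact Finset.sum_congr rfl fun σ _ => by rw [Matrix.smul_mulVec, Matrix.permMatrix_mulVec]
  have hmem : d ∈ {θ : Fin N → ℝ | ∀ i j, |θ j - θ i| < 2 * Real.pi} := by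
    rw [hdsum]; exact convex_gapDom.sum_mem (fun σ _ => hc0 σ) hc1 (fun σ _ => comp_perm_mem_gapDom hθ σ)
  refine ⟨hmem, ?_⟩
  -- Jensen + permutation invariance
  change Real.log (LinearMap.det (duhT v : ChartSU N →ₗ[ℝ] ChartSU N)) ≤
    (fun θ : Fin N → ℝ => ∑ i, ∑ j, Real.log (Real.sinc ((θ j - θ i) / 2))) d
  rw [log_det_duhT_eq h0 hv, hdsum]
  have hJ := concaveOn_logSincSum.le_map_sum (t := Finset.univ) (w := c) (p := fun σ => θ ∘ σ)
    (fun σ _ => hc0 σ) hc1 (fun σ _ => comp_perm_mem_gapDom hθ σ)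
  refine le_trans (le_of_eq ?_) hJ
  simp only [smul_eq_mul, logSincSum_comp_perm]
  rw [← Finset.sum_mul, hc1, one_mul]

end Schur

/-! ## §4 Davis's step: the three-point inequality for `det T_v` on the closed `π`-ball -/

section Davis

variable {N : ℕ}

/-- under `H(w) = U·diag θ·U*`: the eigenvalue angles ARE the (real) diagonal of `H(w)` in the frame `U`. [folklore] -/
theorem eigen_eq_re_diag {w : ChartSU N} {U : Matrix.unitaryGroup (Fin N) ℂ} {θ : Fin N → ℝ}
    (h : herm w = conjDiag U fun k => (θ k : ℂ)) (k : Fin N) :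
    θ k = ((star (U : Matrix (Fin N) (Fin N) ℂ) * herm w * (U : Matrix (Fin N) (Fin N) ℂ)) k k).re := by
  have hdiag : star (U : Matrix (Fin N) (Fin N) ℂ) * herm w * (U : Matrix (Fin N) (Fin N) ℂ) =
      diagonal fun k => (θ k : ℂ) := by
    rw [h]; unfold conjDiag
    calc star (U : Matrix (Fin N) (Fin N) ℂ) *
          ((U : Matrix (Fin N) (Fin N) ℂ) * diagonal (fun k => (θ k : ℂ)) * star (U : Matrix (Fin N) (Fin N) ℂ)) *
          (U : Matrix (Fin N) (Fin N) ℂ)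
        = (star (U : Matrix (Fin N) (Fin N) ℂ) * (U : Matrix (Fin N) (Fin N) ℂ)) * diagonal (fun k => (θ k : ℂ)) *
            (star (U : Matrix (Fin N) (Fin N) ℂ) * (U : Matrix (Fin N) (Fin N) ℂ)) := by
          simp only [Matrix.mul_assoc]
      _ = diagonal fun k => (θ k : ℂ) := by rw [star_coe_mul_coe, Matrix.one_mul, Matrix.mul_one]
  rw [hdiag, diagonal_apply_eq, Complex.ofReal_re]

/-- the real diagonal of `H` in a fixed frame is AFFINE in the chart point. [folklore] -/
theorem re_diag_convexComb (U : Matrix.unitaryGroup (Fin N) ℂ) (v₀ v₁ : ChartSU N) (a b : ℝ) (k : Fin N) :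
    ((star (U : Matrix (Fin N) (Fin N) ℂ) * herm (a • v₀ + b • v₁) * (U : Matrix (Fin N) (Fin N) ℂ)) k k).re =
      a * ((star (U : Matrix (Fin N) (Fin N) ℂ) * herm v₀ * (U : Matrix (Fin N) (Fin N) ℂ)) k k).re +
        b * ((star (U : Matrix (Fin N) (Fin N) ℂ) * herm v₁ * (U : Matrix (Fin N) (Fin N) ℂ)) k k).re := by
  rw [herm_add, herm_smul, herm_smul, Matrix.mul_add, Matrix.add_mul, Matrix.mul_smul, Matrix.smul_mul,
    Matrix.mul_smul, Matrix.smul_mul, Matrix.add_apply, Matrix.smul_apply, Matrix.smul_apply, Complex.add_re,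
    smul_eq_mul, smul_eq_mul, Complex.re_ofReal_mul, Complex.re_ofReal_mul]

/-- a convex combination of two points of the closed `R`-ball lies in it. [folklore] -/
theorem norm_convexComb_le {E : Type*} [SeminormedAddCommGroup E] [NormedSpace ℝ E] {x y : E} {R a b : ℝ}
    (hx : ‖x‖ ≤ R) (hy : ‖y‖ ≤ R) (ha : 0 ≤ a) (hb : 0 ≤ b) (hab : a + b = 1) : ‖a • x + b • y‖ ≤ R := by
  calc ‖a • x + b • y‖ ≤ ‖a • x‖ + ‖b • y‖ := norm_add_le _ _
    _ = a * ‖x‖ + b * ‖y‖ := by rw [norm_smul, norm_smul, Real.norm_of_nonneg ha, Real.norm_of_nonneg hb]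
    _ ≤ a * R + b * R := add_le_add (mul_le_mul_of_nonneg_left hx ha) (mul_le_mul_of_nonneg_left hy hb)
    _ = R := by rw [← add_mul, hab, one_mul]

/-- **DAVIS'S STEP — `log det T` IS CONCAVE ON THE CLOSED `π`-BALL** (two-point form): for `‖v₀‖, ‖v₁‖ ≤ π`,
`0 ≤ a, b`, `a + b = 1`: `a·log det T_{v₀} + b·log det T_{v₁} ≤ log det T_{a v₀ + b v₁}`.  In the eigenframe `U` of
`H(a v₀ + b v₁)` the eigenvalue angles are `a·d⁰ + b·d¹` with `dⁱ` the diagonals of `H(vᵢ)` in that frame (§4), the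
profile is concave on the gap domain (§2) and `profile(dⁱ) ≥ log det T_{vᵢ}` (§3). [folklore] -/
theorem log_det_duhT_convexComb_ge {v₀ v₁ : ChartSU N} (h₀ : ‖v₀‖ ≤ Real.pi) (h₁ : ‖v₁‖ ≤ Real.pi) {a b : ℝ}
    (ha : 0 ≤ a) (hb : 0 ≤ b) (hab : a + b = 1) :
    a * Real.log (LinearMap.det (duhT v₀ : ChartSU N →ₗ[ℝ] ChartSU N)) +
        b * Real.log (LinearMap.det (duhT v₁ : ChartSU N →ₗ[ℝ] ChartSU N)) ≤
      Real.log (LinearMap.det (duhT (a • v₀ + b • v₁) : ChartSU N →ₗ[ℝ] ChartSU N)) := by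
  have hw : ‖a • v₀ + b • v₁‖ ≤ Real.pi := norm_convexComb_le h₀ h₁ ha hb hab
  obtain ⟨U, θ, h⟩ := exists_conjDiag (a • v₀ + b • v₁)
  obtain ⟨hd₀, hle₀⟩ := logSincSum_diag_ge h₀ U
  obtain ⟨hd₁, hle₁⟩ := logSincSum_diag_ge h₁ U
  set d₀ : Fin N → ℝ :=
    fun k => ((star (U : Matrix (Fin N) (Fin N) ℂ) * herm v₀ * (U : Matrix (Fin N) (Fin N) ℂ)) k k).re with hd0
  set d₁ : Fin N → ℝ :=
    fun k => ((star (U : Matrix (Fin N) (Fin N) ℂ) * herm v₁ * (U : Matrix (Fin N) (Fin N) ℂ)) k k).re with hd1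
  have hθ : θ = a • d₀ + b • d₁ := by
    funext k; rw [eigen_eq_re_diag h k, re_diag_convexComb]; simp only [hd0, hd1, Pi.add_apply, Pi.smul_apply, smul_eq_mul]
  have hconc := concaveOn_logSincSum.2 hd₀ hd₁ ha hb hab
  simp only [smul_eq_mul] at hconc
  rw [log_det_duhT_eq h hw, hθ]
  exact le_trans (add_le_add (mul_le_mul_of_nonneg_left hle₀ ha) (mul_le_mul_of_nonneg_left hle₁ hb)) hconc

/-- **THE THREE-POINT INEQUALITY FOR THE `SU(N)` CHART JACOBIAN ON THE CLOSED `π`-BALL**: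
`(det T_{v₀})^a · (det T_{v₁})^b ≤ det T_{a v₀ + b v₁}` for `‖v₀‖, ‖v₁‖ ≤ π`, `0 ≤ a, b`, `a + b = 1` (exponentiate §4;
`det T > 0` on the closed ball, `det_duhT_pos_of_norm_le_pi`). [folklore] -/
theorem det_duhT_threePoint {v₀ v₁ : ChartSU N} (h₀ : ‖v₀‖ ≤ Real.pi) (h₁ : ‖v₁‖ ≤ Real.pi) {a b : ℝ}
    (ha : 0 ≤ a) (hb : 0 ≤ b) (hab : a + b = 1) :
    LinearMap.det (duhT v₀ : ChartSU N →ₗ[ℝ] ChartSU N) ^ a *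
        LinearMap.det (duhT v₁ : ChartSU N →ₗ[ℝ] ChartSU N) ^ b ≤
      LinearMap.det (duhT (a • v₀ + b • v₁) : ChartSU N →ₗ[ℝ] ChartSU N) := by
  have hp₀ := det_duhT_pos_of_norm_le_pi h₀
  have hp₁ := det_duhT_pos_of_norm_le_pi h₁
  have hp := det_duhT_pos_of_norm_le_pi (norm_convexComb_le h₀ h₁ ha hb hab)
  rw [Real.rpow_def_of_pos hp₀, Real.rpow_def_of_pos hp₁, ← Real.exp_add, ← Real.exp_log hp, Real.exp_le_exp,
    mul_comm _ a, mul_comm _ b]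
  exact log_det_duhT_convexComb_ge h₀ h₁ ha hb hab

end Davis

end Summit.QuantumFields.BalabanUV.T4Continuum.ShellMeasureLogConcaveDetSUN
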